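import Mathlib
import Literature.Analysis.FluidPDE.NSTimeRescaleClassical
import Literature.Analysis.FluidPDE.NSLerayHopfABCScaling
import Summits.NavierStokesRegularity.OSWSelfSimilar.TypeIIInnerLimitUnitStream
import HarnessLib
/-!
# The inner-object alternative at ARBITRARY viscosity ν > 0 (zone Z1 TEMPLATE §T1.4-I; kernel, unconditional)

HONEST FRAMING (cell ns-blowup GROUP B «PROFILE SEARCH», zone Z1; D-0035/D-0074): part XXVII of the Z1 dictionary. Parts
XIX–XXVI work at `ν = 1` (TEMPLATE (E0): «viscosity scaled to ν = 1»); K8's standing hypotheses in the tree and the kill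
forms of part VII are stated for every `ν > 0`. This file threads the viscosity through by the time dilation
`v(s, x) = ν⁻¹u(s/ν, x)` (Tao 2011 footnote 3; tree `timeRescale ν⁻¹ ν⁻¹ u`, `IsMaximalSmoothSolution.toUnitViscosity`,
`IsLerayHopfOn.viscosityRescale`), so that the sharpened census sentence of part XXVI holds verbatim for a maximal smooth
axisymmetric Leray–Hopf solution AT VISCOSITY ν, read in the ν-covariant gauge N-a: scale `λ = ν/‖u‖_∞`-type
normalisation `(λₖ/ν)‖u‖ ≤ 1`, parabolic clock `λₖ²/ν`, zoom `y ↦ (λₖ/ν) u(tₖ + λₖ²s/ν, cₖ + λₖy)`: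

* `isAxisymmetric_timeRescale`, `swirl_timeRescale_zero`, `bounded_subslab_timeRescale`, `zoom_timeRescale` —
  bookkeeping of the dilation (axisymmetry, swirl bound `Mₛ/ν`, sub-slab bounds, and the identity of zooms
  `λ • stPull λ² λ t₀ x₀ v = (λ/ν) • stPull (λ²/ν) λ (t₀/ν) x₀ u`);
* `innerLimit_unitStream_or_counterexample_of_singularity_viscosity` — **the part-XXVI headline at any ν > 0**: the inner
  object (a KNSS blow-up limit at unit viscosity — the viscosity is scaled out) is EITHER one unit vector with no
  azimuthal component OR an (AX-L) counterexample (swirl bound `Mₛ/ν`) with the (I-5) signature.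

**Nothing here asserts that a singular solution exists or that (AX-L) holds or fails.** «violates: n/a — dictionary»;
bears_on LADDER-NS N5/Z1 → N1 linear core / N0⁻ ((I-2)–(I-5), general ν). Author: ns-blowup-profile-eng-1 g8, 2026-08-27.
-/

open Real Filter Topology Set MeasureTheory Function Bornology
open scoped ENNReal NNReal
open Literature.Analysis.FluidPDE

namespace Summit.NavierStokesRegularity.OSWSelfSimilar
namespace TypeIIModulationDictionary

section Viscosity

variable {T ν Mₛ : ℝ} {u : ℝ → EuclideanSpace ℝ (Fin 3) → EuclideanSpace ℝ (Fin 3)}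
  {p : ℝ → EuclideanSpace ℝ (Fin 3) → ℝ}

/-- The dilated field `s ↦ a • u(c s)` has axisymmetric slices if `u` has (rotations are linear). [new here —
bookkeeping] -/
theorem isAxisymmetric_timeRescale (haxi : ∀ t, IsAxisymmetric (u t)) (c a : ℝ) (s : ℝ) :
    IsAxisymmetric (timeRescale c a u s) := by
  intro θ x
  rw [timeRescale_slice]
  show a • u (c * s) (rotZ θ x) = rotZ θ (a • u (c * s) x)
  rw [haxi _ θ x, show rotZ θ (a • u (c * s) x) = rotZL θ (a • u (c * s) x) from rfl, map_smul, rotZL_apply]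

/-- The swirl of the dilated datum: `|Γ(a • u(0))| = |a| |Γ(u(0))| ≤ |a| Mₛ` (the swirl is linear in the field).
[new here — bookkeeping] -/
theorem swirl_timeRescale_zero (hMₛ : ∀ x, |swirl (u 0) x| ≤ Mₛ) (c a : ℝ) (x : EuclideanSpace ℝ (Fin 3)) :
    |swirl (timeRescale c a u 0) x| ≤ |a| * Mₛ := by
  have h : swirl (timeRescale c a u 0) x = a * swirl (u 0) x := by
    rw [timeRescale_slice, mul_zero]
    simp only [swirl, PiLp.smul_apply, smul_eq_mul]
    ring
  rw [h, abs_mul]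
  exact mul_le_mul_of_nonneg_left (hMₛ x) (abs_nonneg a)

/-- Sub-slab bounds dilate: if `u` is bounded on every `[0, S] × ℝ³`, `S < T`, then `ν⁻¹u(ν⁻¹ ·)` is bounded on every
`[0, S'] × ℝ³`, `S' < νT` (`ν > 0`). [new here — bookkeeping] -/
theorem bounded_subslab_timeRescale (hν : 0 < ν)
    (hbdd : ∀ S < T, ∃ N : ℝ, 0 < N ∧ ∀ t ∈ Icc 0 S, ∀ x, ‖u t x‖ ≤ N) :
    ∀ S < ν * T, ∃ N : ℝ, 0 < N ∧ ∀ t ∈ Icc 0 S, ∀ x, ‖timeRescale ν⁻¹ ν⁻¹ u t x‖ ≤ N := by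
  intro S hS
  have hS' : S / ν < T := by rw [div_lt_iff₀ hν]; linarith [mul_comm ν T]
  obtain ⟨N, hN, hb⟩ := hbdd (S / ν) hS'
  refine ⟨ν⁻¹ * N, mul_pos (inv_pos.2 hν) hN, fun t ht x => ?_⟩
  rw [timeRescale_apply, norm_smul, Real.norm_eq_abs, abs_of_pos (inv_pos.2 hν)]
  refine mul_le_mul_of_nonneg_left (hb _ ⟨?_, ?_⟩ x) (inv_pos.2 hν).le
  · exact mul_nonneg (inv_pos.2 hν).le ht.1
  · rw [le_div_iff₀ hν]
    calc ν⁻¹ * t * ν = t := by field_simp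
      _ ≤ S := ht.2

/-- **Zooms of the dilated field are ν-covariant zooms of the original**: for `v = ν⁻¹u(ν⁻¹ ·)`,
`λ • stPull λ² λ t₀ x₀ v = (λ/ν) • stPull (λ²/ν) λ (t₀/ν) x₀ u`, i.e.
`λ v(t₀ + λ²s, x₀ + λy) = (λ/ν) u(t₀/ν + (λ²/ν)s, x₀ + λy)` — the gauge N-a zoom at viscosity ν has amplitude `λ/ν` and
parabolic clock `λ²/ν`. [new here — bookkeeping] -/
theorem zoom_timeRescale (ν lam t₀ : ℝ) (x₀ : EuclideanSpace ℝ (Fin 3)) (s : ℝ) :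
    (lam • stPull (lam ^ 2) lam t₀ x₀ (timeRescale ν⁻¹ ν⁻¹ u)) s =
      ((lam / ν) • stPull (lam ^ 2 / ν) lam (ν⁻¹ * t₀) x₀ u) s := by
  funext y
  simp only [Pi.smul_apply, stPull_apply, timeRescale_apply, smul_smul]
  rw [show lam * ν⁻¹ = lam / ν by ring, show ν⁻¹ * (t₀ + lam ^ 2 * s) = ν⁻¹ * t₀ + lam ^ 2 / ν * s by ring]

/-- **THE SHARPENED Z1 CENSUS SENTENCE AT ARBITRARY VISCOSITY ν > 0, UNCONDITIONAL.** Let `(u, p)` be a maximal smooth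
unforced solution AT VISCOSITY ν (`IsMaximalSmoothSolution ν 0 u p T⋆`, `T⋆ > 0`), Leray–Hopf on `[0, T⋆)` at viscosity ν
from `u 0`, bounded on every closed sub-slab, with axisymmetric slices and `|Γ(0, ·)| ≤ Mₛ`. Then there are gauge N-a zoom
data `tₖ ∈ [T⋆/2, T⋆)`, `λₖ > 0`, `λₖ → 0`, centres `cₖ`, with the ν-covariant normalisation `(λₖ/ν)‖u‖ ≤ 1` on `[0, tₖ]`,
and a subsequence along which the zoom `y ↦ (λₖ/ν) u(tₖ + (λₖ²/ν)s, cₖ + λₖy)` converges slice-wise locally uniformly to a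
KNSS blow-up limit `W` (unit viscosity — the viscosity is scaled out; with its Oseen identity) such that EITHER
(α) `W ≡ c` for ONE vector with `‖c‖ = 1`, `c₁ = 0`; OR (β) `AxisymmetricLiouvilleBoundedSwirl` FAILS, witnessed by `W`
(axisymmetric slices, `|Γ_W| ≤ Mₛ/ν`, one non-constant slice) with swirl present, `r‖W_pol‖` unbounded (`violates:
V-CR`), `Γ_W ∉ L^∞_s L^q` (`1 ≤ q < ∞`), `Γ_W` non-decaying. Part XXVI applied to `v = ν⁻¹u(ν⁻¹ ·)`
(`IsMaximalSmoothSolution.toUnitViscosity`, `IsLerayHopfOn.viscosityRescale`) and read back through `zoom_timeRescale`.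
[new here — dictionary; unconditional, any ν > 0] -/
theorem innerLimit_unitStream_or_counterexample_of_singularity_viscosity (hν : 0 < ν) (hT : 0 < T)
    (hmax : IsMaximalSmoothSolution ν 0 u p T) (hLH : IsLerayHopfOn T ν 0 (u 0) u)
    (hbdd : ∀ S < T, ∃ N : ℝ, 0 < N ∧ ∀ t ∈ Icc 0 S, ∀ x, ‖u t x‖ ≤ N)
    (haxi : ∀ t, IsAxisymmetric (u t)) (hMₛ : ∀ x, |swirl (u 0) x| ≤ Mₛ) :
    ∃ (tn lamn : ℕ → ℝ) (cn : ℕ → EuclideanSpace ℝ (Fin 3)) (φ : ℕ → ℕ)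
      (W : ℝ → EuclideanSpace ℝ (Fin 3) → EuclideanSpace ℝ (Fin 3)),
      (∀ k, T / 2 ≤ tn k ∧ tn k < T) ∧ (∀ k, 0 < lamn k) ∧ Tendsto lamn atTop (𝓝 0) ∧
      (∀ k, ∀ t ∈ Icc 0 (tn k), ∀ x, lamn k / ν * ‖u t x‖ ≤ 1) ∧ StrictMono φ ∧ IsKNSSBlowupLimit W ∧
      (∀ s < 0, TendstoLocallyUniformly
        (fun k => ((lamn (φ k) / ν) • stPull (lamn (φ k) ^ 2 / ν) (lamn (φ k)) (tn (φ k)) (cn (φ k)) u) s)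
          (W s) atTop) ∧
      (∀ s t : ℝ, s < t → t < 0 → ∀ x,
        W t x = Literature.Analysis.UnboundedOperators.heatExtension (W s) (t - s) x - oseenDuhamel 1 s W W t x) ∧
      ((∃ c : EuclideanSpace ℝ (Fin 3), ‖c‖ = 1 ∧ c 1 = 0 ∧ ∀ s < 0, ∀ y : EuclideanSpace ℝ (Fin 3), W s y = c) ∨
        (¬ Summit.NavierStokesRegularity.NavierStokesRegularity.AxisymmetricLiouvilleBoundedSwirl ∧
          (∀ s < 0, IsAxisymmetric (W s)) ∧ (∀ s < 0, ∀ y : EuclideanSpace ℝ (Fin 3), |swirl (W s) y| ≤ Mₛ / ν) ∧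
          (∃ s < 0, ∃ x : EuclideanSpace ℝ (Fin 3), W s x ≠ W s 0) ∧
          (∃ s < 0, ∃ x : EuclideanSpace ℝ (Fin 3), swirl (W s) x ≠ 0) ∧
          (∀ C : ℝ, ∃ s < 0, ∃ x : EuclideanSpace ℝ (Fin 3), C < cylRadius x * ‖poloidalPart (W s) x‖) ∧
          (∀ q : ℝ≥0∞, 1 ≤ q → q < ⊤ → ∀ K : ℝ≥0, ∃ s < 0, (K : ℝ≥0∞) < eLpNorm (swirl (W s)) q volume) ∧
          ∃ ε : ℝ, 0 < ε ∧ ∀ R : ℝ, ∃ s < 0, ∃ x : EuclideanSpace ℝ (Fin 3),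
            R ≤ cylRadius x ∧ ε < |swirl (W s) x|)) := by
  -- the unit-viscosity dilation `v(s) = ν⁻¹ u(ν⁻¹ s)`
  set v : ℝ → EuclideanSpace ℝ (Fin 3) → EuclideanSpace ℝ (Fin 3) := timeRescale ν⁻¹ ν⁻¹ u with hv
  have hνT : 0 < ν * T := mul_pos hν hT
  have hmax' : IsMaximalSmoothSolution 1 0 v (timeRescale ν⁻¹ (ν⁻¹ ^ 2) p) (ν * T) := hmax.toUnitViscosity hν
  have hv0 : v 0 = ν⁻¹ • u 0 := by
    funext x
    simp [hv, timeRescale_apply]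
  have hLH' : IsLerayHopfOn (ν * T) 1 0 (v 0) v := by
    have h := hLH.viscosityRescale (inv_pos.2 hν)
    rw [inv_mul_cancel₀ hν.ne', timeRescale_zero_force, div_inv_eq_mul, mul_comm T ν] at h
    rwa [hv0]
  have hbdd' := bounded_subslab_timeRescale (u := u) hν hbdd
  have haxi' : ∀ t, IsAxisymmetric (v t) := fun t => isAxisymmetric_timeRescale haxi _ _ t
  have hMₛ' : ∀ x, |swirl (v 0) x| ≤ Mₛ / ν := fun x => by
    have h := swirl_timeRescale_zero (u := u) hMₛ ν⁻¹ ν⁻¹ x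
    rwa [abs_of_pos (inv_pos.2 hν), inv_mul_eq_div] at h
  obtain ⟨tn', lamn, cn, φ, W, htn', hlam, hlam0, hgauge', hφ, hW, hconv', hmild, halt⟩ :=
    innerLimit_unitStream_or_counterexample_of_singularity hνT hmax' hLH' hbdd' haxi' hMₛ'
  refine ⟨fun k => ν⁻¹ * tn' k, lamn, cn, φ, W, fun k => ⟨?_, ?_⟩, hlam, hlam0, fun k t ht x => ?_, hφ, hW,
    fun s hs => ?_, hmild, halt⟩
  · -- `T/2 ≤ ν⁻¹ tₖ'`
    have h := (htn' k).1
    rw [le_inv_mul_iff₀' hν]; linarith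
  · have h := (htn' k).2
    rw [inv_mul_lt_iff₀ hν]; linarith [mul_comm ν T]
  · -- the ν-covariant gauge bound from `λₖ‖v(νt)‖ ≤ 1`
    have hνt : ν * t ∈ Icc 0 (tn' k) := by
      refine ⟨mul_nonneg hν.le ht.1, ?_⟩
      have := ht.2
      rw [le_inv_mul_iff₀' hν] at this
      linarith [mul_comm ν t]
    have h := hgauge' k (ν * t) hνt x
    rw [hv, timeRescale_apply, ← mul_assoc, inv_mul_cancel₀ hν.ne', one_mul, norm_smul, Real.norm_eq_abs,
      abs_of_pos (inv_pos.2 hν)] at h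
    calc lamn k / ν * ‖u t x‖ = lamn k * (ν⁻¹ * ‖u t x‖) := by ring
      _ ≤ 1 := h
  · -- the zooms of `v` ARE the ν-covariant zooms of `u`
    refine (hconv' s hs).congr fun k => ?_
    rw [hv, zoom_timeRescale]
    intro x
    rfl

end Viscosity

end TypeIIModulationDictionary
end Summit.NavierStokesRegularity.OSWSelfSimilar
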